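import Summits.AtomisticToContinuum.Crystallization.Theorems.FreeSplittingCertificatesStrictSplittingRuleP1CellVarianceW
import Summits.AtomisticToContinuum.Crystallization.Theorems.FreeSplittingCertificatesStrictSplittingRuleP1VertexRegroup
import Summits.AtomisticToContinuum.Crystallization.Theorems.FreeSplittingCertificatesStrictSplittingRuleP1TransferRec

/-!
# `StrictSplittingRule` (stmt-AtomisticToContinuum-12560): the GLOBAL bare-demand transfer with the matched split — lattice vertex form ≤ continuum integral of the interpolant + edge energy (P1 interpolant object, part 27)

Route `FreeSplittingCertificates`, crux r3 `StrictSplittingRule` (H12⋆ = `stub_coreJointCoercive`), unit b2b-freesplit-B gen 22.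
VALUE = item (2''') of HOME FAR-LEMMA-SPEC §17 (e), the RADIAL-DEFICIT half, as one tree statement: for a continuous positive semidefinite
weight `W(x)` (cellwise bounded by `w_T·I`), any lattice values `V : ℤ³ → ℝ³` with interpolant `ṽ = p1Field a h V`, the MATCHED lattice bare form
`Σ'_q q̄_q(V q)`, `q̄_q(u) := Σ_{cells T ∋ q, q = vertex m of T} ∫_T λ_m(y)·q_{W(y)}(u) dy` (= `∫ φ_q(y) q_{W(y)}(u) dy`, the hat-average — `p1SiteBare`),
is bounded by the continuum bare integral of the interpolant plus edge-difference energy: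
`Σ'_q p1SiteBare q ≤ ∫ q_{W}(ṽ) + (√3a²h/192)·½·Σ'_T w_T·Σ_{m,m'}|V(vert_m T) − V(vert_{m'} T)|²`   (**`tsum_p1SiteBare_le`**)
— `D = 1`, no weight comparison; the defect is charged to the readout inflation `f` by the element algebra (next part).  Hypotheses: integrability of
`q_W(ṽ)` and summability of the defect family (discharged in the assembly from the decay of `W = χ²·2|x|⁻⁸x̂x̂ᵀ` and the affine-plus-compact structure of
`V`).  Ingredients: parts 24–26 (`vertex_quadrature_excess_var_p1RealCell`, `tsum_cellVertex_eq_tsum_site`) and the cells decomposition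
`hasSum_setIntegral_p1RealCell` (part 15).  NOT a proof of H12⋆, NOT summit progress.  [folklore]
-/

noncomputable section

open Set Function Metric MeasureTheory Filter Topology
open scoped BigOperators NNReal ENNReal

namespace Summit.AtomisticToContinuum.Crystallization.Theorems.StrictSplittingRuleBirth

/-- The vertex values of cell `i = (n, π)` read from a lattice function `V`. -/
def p1CellVals (V : ℤ × ℤ × ℤ → (Fin 3 → ℝ)) (i : (ℤ × ℤ × ℤ) × Fin 6) (m : Fin 4) : Fin 3 → ℝ :=
  V (i.1 + p1VertOff (p1Par i.1) i.2 m)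

/-- **On a cell the interpolant is the barycentric combination of the cell's vertex values** (componentwise form of `p1Interp_eq_sum`). -/
theorem p1Field_eq_sum_p1Lam {a h : ℝ} (V : ℤ × ℤ × ℤ → (Fin 3 → ℝ)) {i : (ℤ × ℤ × ℤ) × Fin 6} {y : Fin 3 → ℝ} (hy : y ∈ p1RealCell a h i) :
    p1Field a h V y = fun k => ∑ m, p1Lam a h i m y * p1CellVals V i m k := by
  have hq : p1ChartInv a h y ∈ p1Cell i := hy
  funext k
  rw [p1Field, p1Interp_eq_sum V hq, Finset.sum_apply]
  simp only [Pi.smul_apply, smul_eq_mul, p1Lam, p1CellVals]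

/-- The per-cell vertex term of the matched lattice bare form: `Σ_m ∫_T λ_m·q_W(v_m)`. -/
def p1CellBare (a h : ℝ) (W : (Fin 3 → ℝ) → Fin 3 → Fin 3 → ℝ) (V : ℤ × ℤ × ℤ → (Fin 3 → ℝ)) (i : (ℤ × ℤ × ℤ) × Fin 6) (m : Fin 4) : ℝ :=
  ∫ y in p1RealCell a h i, p1Lam a h i m y * p1Quad3 (W y) (p1CellVals V i m)

/-- **The matched lattice bare form at site `q`**: the hat-average of the continuum bare density around `q` applied to `V q`, written as the
sum over the cells cornering at `q` (`Σ_{o} Σ_{π,m} [vertex m of cell (q−o,π) is q] ∫_{cell} λ_m q_W(V q)`). -/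
def p1SiteBare (a h : ℝ) (W : (Fin 3 → ℝ) → Fin 3 → Fin 3 → ℝ) (V : ℤ × ℤ × ℤ → (Fin 3 → ℝ)) (q : ℤ × ℤ × ℤ) : ℝ :=
  ∑ o ∈ p1Corners, ∑ π : Fin 6, ∑ m : Fin 4,
    if p1VertOff (p1Par (q - o)) π m = o then p1CellBare a h W V (q - o, π) m else 0

/-- The per-cell edge-difference energy `½Σ_{m,m'}|v_m − v_{m'}|²` of the vertex values. -/
def p1CellEdgeEnergy (V : ℤ × ℤ × ℤ → (Fin 3 → ℝ)) (i : (ℤ × ℤ × ℤ) × Fin 6) : ℝ :=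
  1 / 2 * ∑ m : Fin 4, ∑ m' : Fin 4, ((p1CellVals V i m 0 - p1CellVals V i m' 0) ^ 2 + (p1CellVals V i m 1 - p1CellVals V i m' 1) ^ 2 +
    (p1CellVals V i m 2 - p1CellVals V i m' 2) ^ 2)

/-- Edge energies are nonnegative. -/
theorem p1CellEdgeEnergy_nonneg (V : ℤ × ℤ × ℤ → (Fin 3 → ℝ)) (i : (ℤ × ℤ × ℤ) × Fin 6) : 0 ≤ p1CellEdgeEnergy V i := by
  unfold p1CellEdgeEnergy
  exact mul_nonneg (by norm_num) (Finset.sum_nonneg fun m _ => Finset.sum_nonneg fun m' _ => by positivity)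

/-- The per-cell vertex terms are nonnegative (for `W ⪰ 0` on the cell). -/
theorem p1CellBare_nonneg {a h : ℝ} {W : (Fin 3 → ℝ) → Fin 3 → Fin 3 → ℝ} (V : ℤ × ℤ × ℤ → (Fin 3 → ℝ)) (i : (ℤ × ℤ × ℤ) × Fin 6)
    (hW0 : ∀ y ∈ p1RealCell a h i, ∀ u : Fin 3 → ℝ, 0 ≤ p1Quad3 (W y) u) (m : Fin 4) : 0 ≤ p1CellBare a h W V i m :=
  setIntegral_nonneg (isClosed_p1RealCell a h i).measurableSet fun y hy => mul_nonneg (p1Lam_nonneg_of_mem hy m) (hW0 y hy _)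

/-- **THE GLOBAL BARE-DEMAND TRANSFER (matched split, radial-deficit half).**  For a continuous weight `W`, positive semidefinite and cellwise
bounded (`q_{W(y)}(u) ≤ w_T|u|²` on cell `T`), lattice values `V` with interpolant `ṽ = p1Field a h V`, assuming `q_W(ṽ)` integrable and the
defect family summable:
`Σ'_q p1SiteBare q ≤ ∫ q_W(ṽ) + (√3a²h/192)·Σ'_T w_T·p1CellEdgeEnergy V T`.  NOT a proof of H12⋆, NOT summit progress. -/
theorem tsum_p1SiteBare_le {a h : ℝ} (ha : 0 < a) (hh : 0 < h) (W : (Fin 3 → ℝ) → Fin 3 → Fin 3 → ℝ) (hWc : ∀ k l, Continuous fun x => W x k l)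
    (hW0 : ∀ y : Fin 3 → ℝ, ∀ u : Fin 3 → ℝ, 0 ≤ p1Quad3 (W y) u) (wT : (ℤ × ℤ × ℤ) × Fin 6 → ℝ)
    (hwT : ∀ i, ∀ y ∈ p1RealCell a h i, ∀ u : Fin 3 → ℝ, p1Quad3 (W y) u ≤ wT i * (u 0 ^ 2 + u 1 ^ 2 + u 2 ^ 2))
    (V : ℤ × ℤ × ℤ → (Fin 3 → ℝ)) (hint : Integrable fun y => p1Quad3 (W y) (p1Field a h V y))
    (hdef : Summable fun i => wT i * p1CellEdgeEnergy V i) :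
    Summable (p1SiteBare a h W V) ∧
    ∑' q, p1SiteBare a h W V q ≤ (∫ y, p1Quad3 (W y) (p1Field a h V y)) + √3 * a ^ 2 * h / 192 * ∑' i, wT i * p1CellEdgeEnergy V i := by
  have ha' := ha.ne'
  have hh' := hh.ne'
  -- per-cell inequality
  have hcell : ∀ i, ∑ m, p1CellBare a h W V i m ≤
      (∫ y in p1RealCell a h i, p1Quad3 (W y) (p1Field a h V y)) + √3 * a ^ 2 * h / 192 * (wT i * p1CellEdgeEnergy V i) := by
    intro i
    have h1 := vertex_quadrature_excess_var_p1RealCell ha hh i W hWc (fun y _ u => hW0 y u) (hwT i) (p1CellVals V i)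
    have h2 : ∫ y in p1RealCell a h i, p1Quad3 (W y) (fun k => ∑ m, p1Lam a h i m y * p1CellVals V i m k) =
        ∫ y in p1RealCell a h i, p1Quad3 (W y) (p1Field a h V y) :=
      setIntegral_congr_fun (isClosed_p1RealCell a h i).measurableSet fun y hy => by rw [p1Field_eq_sum_p1Lam V hy]
    unfold p1CellBare p1CellEdgeEnergy
    rw [← h2]
    linarith
  -- the three families
  have hB : HasSum (fun i => ∫ y in p1RealCell a h i, p1Quad3 (W y) (p1Field a h V y)) (∫ y, p1Quad3 (W y) (p1Field a h V y)) :=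
    hasSum_setIntegral_p1RealCell ha' hh' hint
  have hA0 : ∀ i, 0 ≤ ∑ m, p1CellBare a h W V i m := fun i => Finset.sum_nonneg fun m _ => p1CellBare_nonneg V i (fun y _ u => hW0 y u) m
  have hdef' : Summable fun i => √3 * a ^ 2 * h / 192 * (wT i * p1CellEdgeEnergy V i) := hdef.mul_left _
  have hsum : Summable fun i => (∫ y in p1RealCell a h i, p1Quad3 (W y) (p1Field a h V y)) +
      √3 * a ^ 2 * h / 192 * (wT i * p1CellEdgeEnergy V i) := hB.summable.add hdef'
  have hA : Summable fun i => ∑ m, p1CellBare a h W V i m := Summable.of_nonneg_of_le hA0 hcell hsum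
  -- regroup the vertex family to sites
  have hg0 : ∀ n π m, 0 ≤ p1CellBare a h W V (n, π) m := fun n π m => p1CellBare_nonneg V (n, π) (fun y _ u => hW0 y u) m
  have hAf : HasSum (fun n : ℤ × ℤ × ℤ => ∑ π : Fin 6, ∑ m : Fin 4, p1CellBare a h W V (n, π) m) (∑' i, ∑ m, p1CellBare a h W V i m) :=
    hA.hasSum.prod_fiberwise fun n => hasSum_fintype _
  obtain ⟨hS, hEq⟩ := tsum_cellVertex_eq_tsum_site (g := fun n π m => p1CellBare a h W V (n, π) m) hg0 hAf.summable
  have hSite : (fun q => ∑ o ∈ p1Corners, ∑ π : Fin 6, ∑ m : Fin 4,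
      if p1VertOff (p1Par (q - o)) π m = o then p1CellBare a h W V (q - o, π) m else 0) = p1SiteBare a h W V := by
    funext q; rfl
  rw [hSite] at hS hEq
  refine ⟨hS, ?_⟩
  rw [← hEq, hAf.tsum_eq]
  calc ∑' i, ∑ m, p1CellBare a h W V i m
      ≤ ∑' i, ((∫ y in p1RealCell a h i, p1Quad3 (W y) (p1Field a h V y)) + √3 * a ^ 2 * h / 192 * (wT i * p1CellEdgeEnergy V i)) :=
        Summable.tsum_le_tsum hcell hA hsum
    _ = (∑' i, ∫ y in p1RealCell a h i, p1Quad3 (W y) (p1Field a h V y)) + ∑' i, √3 * a ^ 2 * h / 192 * (wT i * p1CellEdgeEnergy V i) :=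
        hB.summable.tsum_add hdef'
    _ = (∫ y, p1Quad3 (W y) (p1Field a h V y)) + √3 * a ^ 2 * h / 192 * ∑' i, wT i * p1CellEdgeEnergy V i := by
        rw [hB.tsum_eq, tsum_mul_left]

end Summit.AtomisticToContinuum.Crystallization.Theorems.StrictSplittingRuleBirth
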